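import Summits.AtomisticToContinuum.HydrodynamicLimit.Theses.ImplosionDichotomy
import Literature.MathematicalPhysics.KineticTheory.HardSphereEulerLLN
import Summits.AtomisticToContinuum.HydrodynamicLimit.Theorems.ImplosionDichotomyPolynomialCompressionStaticsLLN
import Summits.AtomisticToContinuum.HydrodynamicLimit.Theorems.ImplosionDichotomyPolynomialCompressionStaticsSmoothRate
import Summits.AtomisticToContinuum.HydrodynamicLimit.Theorems.ImplosionDichotomyPolynomialCompressionLogBudgetShadowing
import Summits.AtomisticToContinuum.HydrodynamicLimit.Theorems.ImplosionDichotomyPolynomialCompressionConditionalExistence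
import Summits.AtomisticToContinuum.HydrodynamicLimit.Theorems.ImplosionDichotomyHsEosLowDensity
import Summits.AtomisticToContinuum.HydrodynamicLimit.Theorems.ImplosionDichotomyTypeOneIdealImplosionOfLeftHyp

/-!
# `PolynomialCompression` from a Type-I ideal-gas implosion (the line `log-lipschitz-budget`, assembled)

Helper file (lead c2) for the crux `ImplosionDichotomy.PolynomialCompression`
(stmt-AtomisticToContinuum-12587, route `route-AtomisticToContinuum-ImplosionDichotomy`,
`AtomisticToContinuum/HydrodynamicLimit`).

The registered line `log-lipschitz-budget` proves the crux from four stubs; three of them are landed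
theorems of this directory (`stub_staticsLLN` p71479 + `stub_staticsSmoothRate` p71863 = quantitative smooth
statics of the local Gibbs laws; `stub_conditionalExistence` p106435 = Kato/Majda classical existence from
a-priori bounds for the hard-sphere system; `stub_logBudgetShadowing` p115212 = the a-priori log-Lipschitz-budget
shadowing estimate), and the equation of state `HsEosLowDensity` is proved (`hsEosLowDensity_proof`, p75216).
The fourth, `stub_typeOneImplosion` — a Type-I self-similar implosion of the monatomic ideal gas on `𝕋³` with
unit-mass isentropic data and four rate clauses — is, verbatim, the route support item
`TypeOneIdealImplosion` (stmt-AtomisticToContinuum-15146), landed modulo the single named Literature fact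
`Literature.Analysis.FluidPDE.BuckmasterCaolaboraGomezserrano2025_thm11_monatomic` (the `γ = 5/3` profile of
Buckmaster–Cao-Labora–Gómez-Serrano) as `typeOneIdealImplosion_of_thm11` (p109049), and modulo the certificate
layer `∀ r ∈ Icc Shooting.rd Shooting.ru, LeftAsm.LeftHyp r` of that fact as `typeOneIdealImplosion_of_leftHyp`
(p116279).

This file lands the COMPOSITION of the line with stub 1 as its only hypothesis, so that the crux closes by a
one-line application the moment the profile fact (in either form) is a theorem:

* `polynomialCompression_of_typeOne : <TypeOneIdealImplosion signature> → PolynomialCompression` — quantifier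
  bookkeeping plus the exponent algebra: with the reference core `≥ c(T₁−t)^{−β}`, the statics family
  `ρ₀^σ = rhoLim (profileOf a₀) σ`, the packing threshold `η₁` of the existence theory and the exit exponent
  `e` of the shadowing estimate, take `κ := eβ/2`; given `σ₀` choose
  `σ := min(σ₀/2, σ₂/2, (min(c/2,1))^{2/(eβ)})`; classical existence on `[0, T₁ − σ^e/2)` from stubs 3 + 4,
  the `t = 0` law of large numbers from the statics transported to the solution's own fields, and at the
  exit time `tₑ = T₁ − σ^e`: `ρ tₑ x ≥ ρ₁ tₑ x / 2 ≥ (c/2) σ^{−eβ} ≥ σ^{−eβ/2}`;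
* `polynomialCompression_of_thm11 : BuckmasterCaolaboraGomezserrano2025_thm11_monatomic → PolynomialCompression`;
* `polynomialCompression_of_leftHyp : (∀ r ∈ Icc Shooting.rd Shooting.ru, LeftAsm.LeftHyp r) → PolynomialCompression`.
-/

noncomputable section

namespace Summit.AtomisticToContinuum.HydrodynamicLimit.Theorems

open Set MeasureTheory Filter
open Literature.MathematicalPhysics.KineticTheory
open Literature.Analysis.FunctionSpaces
open Literature.Analysis.FluidPDE
open Literature.Analysis.FluidPDE.BuckmasterCaolaboraGomezserrano2025.Monatomic

/-- **Quantitative smooth statics** (stubs 2a + 2b of the line glued). For a smooth positive activity `a₀`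
and continuous `u₀`, `θ₀ > 0` there are `σ₁ > 0` and a family `σ ↦ ρ₀^σ` such that for `0 < σ < σ₁`:
`ρ₀^σ` is smooth and positive, the empirical density/momentum/energy fields of the local Gibbs laws at
`t = 0` satisfy the LLN towards `(ρ₀^σ, u₀, θ₀)` for EVERY flow family, and `‖ρ₀^σ − a₀/∫a₀‖_{Cⁿ} ≤ Cₙ σ³`
for every `n`. Witness: `ρ₀^σ := rhoLim (profileOf a₀) σ`. [folklore] -/
theorem smoothStatics_of_stubs :
    ∀ (a₀ θ₀ : T3 → ℝ) (u₀ : T3 → V3), Torus.IsSmooth a₀ → Continuous θ₀ → Continuous u₀ →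
      (∀ x, 0 < a₀ x) → (∀ x, 0 < θ₀ x) →
      ∃ σ₁ : ℝ, 0 < σ₁ ∧ ∃ ρs : ℝ → T3 → ℝ,
        (∀ σ : ℝ, 0 < σ → σ < σ₁ →
          Torus.IsSmooth (ρs σ) ∧ (∀ x, 0 < ρs σ x) ∧
          ∀ Φ : (N : ℕ) → Literature.Analysis.FluidPDE.HardSphereFlow
              (Literature.Analysis.FluidPDE.Torus.geometry (Fin 3)) (hsDiameter σ N) (N + 1),
            TendstoHydroFieldsAt (fun N => localGibbsLaw σ a₀ u₀ θ₀ N (Φ N)) Φ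
              (fun _ => ρs σ) (fun _ => u₀) (fun _ => θ₀) 0) ∧
        (∀ n : ℕ, ∃ Cn : ℝ, ∀ σ : ℝ, 0 < σ → σ < σ₁ → ∀ y : EuclideanSpace ℝ (Fin 3),
          ‖iteratedFDeriv ℝ n (Torus.lift (fun x => ρs σ x - a₀ x / ∫ z, a₀ z)) y‖ ≤ Cn * σ ^ 3) := by
  intro a₀ θ₀ u₀ ha hθ hu ha0 hθ0
  obtain ⟨σ₁, hσ₁, H⟩ := stub_staticsLLN a₀ θ₀ u₀ ha.continuous hθ hu ha0 hθ0
  obtain ⟨hsmooth, hrate⟩ := stub_staticsSmoothRate a₀ ha ha0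
  refine ⟨σ₁, hσ₁, fun σ => rhoLim (profileOf a₀ ha.continuous ha0) σ, ?_, ?_⟩
  · intro σ hσ hσ'
    obtain ⟨hsd, hpos, hlln⟩ := H σ hσ hσ'
    exact ⟨hsmooth σ hsd, hpos, hlln⟩
  · intro n
    obtain ⟨Cn, hCn⟩ := hrate n
    exact ⟨Cn, fun σ hσ hσ' y => hCn σ (H σ hσ hσ').1 y⟩

/-- The `t = 0` LLN clause only sees the time-zero slices of the fields: if `(ρ, u, θ)(0) = (ρ₀, u₀, θ₀)`
then the LLN towards the constant-in-time fields `(ρ₀, u₀, θ₀)` at `t = 0` is the LLN towards `(ρ, u, θ)`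
at `t = 0`. [folklore] -/
theorem tendstoHydroFieldsAt_zero_of_data_eq {ε : ℕ → ℝ}
    {P : (N : ℕ) → Measure (Literature.Analysis.FluidPDE.Config (N + 1) (Fin 3) T3)}
    {Φ : (N : ℕ) → Literature.Analysis.FluidPDE.HardSphereFlow
      (Literature.Analysis.FluidPDE.Torus.geometry (Fin 3)) (ε N) (N + 1)}
    {ρ θ : ℝ → T3 → ℝ} {u : ℝ → T3 → V3} {ρ₀ θ₀ : T3 → ℝ} {u₀ : T3 → V3}
    (hρ : ρ 0 = ρ₀) (hu : u 0 = u₀) (hθ : θ 0 = θ₀)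
    (h : TendstoHydroFieldsAt P Φ (fun _ => ρ₀) (fun _ => u₀) (fun _ => θ₀) 0) :
    TendstoHydroFieldsAt P Φ ρ u θ 0 := by
  unfold TendstoHydroFieldsAt at h ⊢
  intro χ hχ δ hδ
  obtain ⟨h1, h2, h3⟩ := h χ hχ δ hδ
  refine ⟨?_, ?_, ?_⟩
  · simpa only [hρ] using h1
  · simpa only [hρ, hu] using h2
  · simpa only [hρ, hu, hθ] using h3

/-- **`PolynomialCompression` from a Type-I ideal-gas implosion** (the line `log-lipschitz-budget` assembled:
the hypothesis is verbatim the route support item `TypeOneIdealImplosion`, stmt-AtomisticToContinuum-15146 =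
stub 1 of the line; statics, conditional existence, the log-budget shadowing estimate and the equation of
state are the landed theorems). With the reference core `≥ c(T₁−t)^{−β}` and the exit exponent `e` of the
shadowing estimate, `κ := eβ/2`; for `σ₀ > 0` take `σ := min(σ₀/2, σ₂/2, (min(c/2,1))^{2/(eβ)})`, the
classical solution on `[0, T₁ − σ^e/2)` given by conditional existence fed with the a-priori bounds, the
`t = 0` tie from the statics, and the compression `ρ ≥ ρ₁/2 ≥ (c/2)σ^{−eβ} ≥ σ^{−κ}` at `tₑ = T₁ − σ^e`. -/
theorem polynomialCompression_of_typeOne :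
    (∃ (a₀ θ₀ : T3 → ℝ) (u₀ : T3 → V3), Torus.IsSmooth a₀ ∧ Torus.IsSmooth θ₀ ∧ Torus.IsSmooth u₀ ∧
      (∀ x, 0 < a₀ x) ∧ (∀ x, 0 < θ₀ x) ∧
      ∃ (T₁ K : ℝ) (ρ₁ θ₁ : ℝ → T3 → ℝ) (u₁ : ℝ → T3 → V3), 0 < T₁ ∧ 0 < K ∧
        IsHardSphereEulerSolution 0 T₁ ρ₁ u₁ θ₁ ∧
        (∀ x, ρ₁ 0 x = a₀ x / ∫ y, a₀ y) ∧ u₁ 0 = u₀ ∧ θ₁ 0 = θ₀ ∧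
        (∀ t ∈ Ico 0 T₁, ∀ x, θ₁ t x = K * ρ₁ t x ^ (2 / 3 : ℝ)) ∧
        (∃ C : ℝ, ∀ t ∈ Ico 0 T₁, ∀ x, ∀ i : Fin 3,
            ‖Torus.partialDeriv i (u₁ t) x‖ ≤ C / (T₁ - t) ∧
            |Torus.partialDeriv i (fun y => ρ₁ t y ^ (1 / 3 : ℝ)) x| ≤ C / (T₁ - t)) ∧
        (∀ n : ℕ, n ≤ 6 → ∃ Cn pn : ℝ, ∀ t ∈ Ico 0 T₁, ∀ y : EuclideanSpace ℝ (Fin 3),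
            ‖iteratedFDeriv ℝ n (Torus.lift (ρ₁ t)) y‖ ≤ Cn * (T₁ - t) ^ (-pn) ∧
            ‖iteratedFDeriv ℝ n (Torus.lift (u₁ t)) y‖ ≤ Cn * (T₁ - t) ^ (-pn)) ∧
        (∃ cl pl : ℝ, 0 < cl ∧ ∀ t ∈ Ico 0 T₁, ∀ x, cl * (T₁ - t) ^ pl ≤ ρ₁ t x) ∧
        ∃ β c : ℝ, 0 < β ∧ 0 < c ∧ ∀ t ∈ Ico 0 T₁, ∃ x, c * (T₁ - t) ^ (-β) ≤ ρ₁ t x) →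
    Summit.AtomisticToContinuum.HydrodynamicLimit.Theses.ImplosionDichotomy.PolynomialCompression := by
  intro hT1
  classical
  unfold Summit.AtomisticToContinuum.HydrodynamicLimit.Theses.ImplosionDichotomy.PolynomialCompression
  -- the equation of state (route support, proved)
  obtain ⟨η₀, hη₀, F, hF, hEq, hF0, hF', -⟩ := hsEosLowDensity_proof
  -- the σ = 0 reference (stub 1, the hypothesis)
  obtain ⟨a₀, θ₀, u₀, ha, hθ, hu, ha0, hθ0, T₁, K, ρ₁, θ₁, u₁, hT₁, hK, hsol₁, hρ₁0, hu₁0, hθ₁0,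
    hisen, htypeI, hpoly, hlow, β, c, hβ, hc, hfloor⟩ := hT1
  -- quantitative statics (stub 2)
  obtain ⟨σ₁, hσ₁, ρs, hfam, hrate⟩ :=
    smoothStatics_of_stubs a₀ θ₀ u₀ ha hθ.continuous hu.continuous ha0 hθ0
  -- existence theory (stub 3)
  obtain ⟨η₁, hη₁, Hex⟩ := stub_conditionalExistence η₀ hη₀ F hF hEq hF0 hF'
  -- a-priori shadowing (stub 4), at the packing target η₁
  obtain ⟨e, he, σ₂, hσ₂, hσ₂₁, Hap⟩ :=
    stub_logBudgetShadowing η₀ hη₀ F hF hEq hF0 hF' (fun x => a₀ x / ∫ y, a₀ y) θ₀ u₀ T₁ K ρ₁ θ₁ u₁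
      hT₁ hK hsol₁ hρ₁0 hu₁0 hθ₁0 hisen htypeI hpoly hlow ρs σ₁ hσ₁
      (fun σ hσ hσ' => ⟨(hfam σ hσ hσ').1, (hfam σ hσ hσ').2.1⟩) hrate η₁ hη₁
  -- the witness: κ := e β / 2 and the reference profiles
  refine ⟨e * β / 2, by positivity, a₀, θ₀, u₀, ha.continuous, hθ.continuous, hu.continuous, ha0, hθ0, ?_⟩
  intro σ₀ hσ₀
  -- smallness threshold for the exponent bookkeeping
  set m : ℝ := min (c / 2) 1 with hm
  have hm0 : 0 < m := lt_min (by positivity) one_pos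
  have hmc : m ≤ c / 2 := min_le_left _ _
  set σ₃ : ℝ := m ^ (2 / (e * β)) with hσ₃
  have hσ₃0 : 0 < σ₃ := Real.rpow_pos_of_pos hm0 _
  set σ : ℝ := min (σ₀ / 2) (min (σ₂ / 2) σ₃) with hσdef
  have hσ0 : 0 < σ := lt_min (by positivity) (lt_min (by positivity) hσ₃0)
  have hσσ₀ : σ < σ₀ := (min_le_left _ _).trans_lt (by linarith)
  have hσσ₂ : σ < σ₂ := ((min_le_right _ _).trans (min_le_left _ _)).trans_lt (by linarith)
  have hσσ₃ : σ ≤ σ₃ := (min_le_right _ _).trans (min_le_right _ _)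
  have hσσ₁ : σ < σ₁ := hσσ₂.trans_le hσ₂₁
  refine ⟨σ, hσ0, hσσ₀, ?_⟩
  obtain ⟨hσT, hpack, M, hM, Hbnd⟩ := Hap σ hσ0 hσσ₂
  have hδ : 0 < σ ^ e := Real.rpow_pos_of_pos hσ0 e
  -- the horizon of classical existence
  set T' : ℝ := T₁ - σ ^ e / 2 with hT'
  have hT'pos : 0 < T' := by rw [hT']; linarith
  obtain ⟨hsm, hpos, hLLN⟩ := hfam σ hσ0 hσσ₁
  obtain ⟨ρ, θ, u, hsol, hρ0, hu0, hθ0'⟩ :=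
    Hex σ hσ0 (ρs σ) θ₀ u₀ hsm hθ hu hpos hθ0 hpack T' M hT'pos hM
      (fun T hT ρ θ u hs h1 h2 h3 t ht x => (Hbnd T hT ρ θ u hs h1 h2 h3 t ht x).1)
  refine ⟨T', ρ, θ, u, hsol, ?_, ?_⟩
  · -- admissibility: the t = 0 LLN tie (stub 2), transported to the solution's own fields
    intro Φ
    exact tendstoHydroFieldsAt_zero_of_data_eq hρ0 hu0 hθ0' (hLLN Φ)
  · -- compression at the exit time tₑ := T₁ - σ ^ e
    set tₑ : ℝ := T₁ - σ ^ e with htₑ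
    have htₑ0 : 0 ≤ tₑ := by rw [htₑ]; linarith
    have htₑT : tₑ < T' := by rw [htₑ, hT']; linarith
    have htₑ1 : tₑ ∈ Ico 0 T₁ := ⟨htₑ0, by rw [htₑ]; linarith⟩
    obtain ⟨x, hx⟩ := hfloor tₑ htₑ1
    refine ⟨tₑ, ⟨htₑ0, htₑT⟩, x, ?_⟩
    have hclose : ρ₁ tₑ x ≤ 2 * ρ tₑ x :=
      (Hbnd T' le_rfl ρ θ u hsol hρ0 hu0 hθ0' tₑ ⟨htₑ0, htₑT⟩ x).2
    -- the reference floor at the exit time: c * σ ^ (e * -β) ≤ ρ₁ tₑ x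
    have hTt : T₁ - tₑ = σ ^ e := by rw [htₑ]; ring
    rw [hTt, ← Real.rpow_mul hσ0.le] at hx
    -- smallness: σ ^ (e β / 2) ≤ c / 2
    have hsmall : σ ^ (e * β / 2) ≤ c / 2 := by
      have h1 : σ ^ (e * β / 2) ≤ σ₃ ^ (e * β / 2) :=
        Real.rpow_le_rpow hσ0.le hσσ₃ (by positivity)
      have h2 : σ₃ ^ (e * β / 2) = m := by
        rw [hσ₃, ← Real.rpow_mul hm0.le]
        have : 2 / (e * β) * (e * β / 2) = 1 := by
          field_simp
        rw [this, Real.rpow_one]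
      exact (h1.trans_eq h2).trans hmc
    -- exponent algebra
    have hA : 0 < σ ^ (-(e * β / 2)) := Real.rpow_pos_of_pos hσ0 _
    have hAA : σ ^ (e * -β) = σ ^ (-(e * β / 2)) * σ ^ (-(e * β / 2)) := by
      rw [← Real.rpow_add hσ0]; congr 1; ring
    have hinv : σ ^ (e * β / 2) = (σ ^ (-(e * β / 2)))⁻¹ := by
      rw [Real.rpow_neg hσ0.le, inv_inv]
    have h1 : 1 ≤ c / 2 * σ ^ (-(e * β / 2)) := by
      rw [hinv] at hsmall
      have := mul_le_mul_of_nonneg_right hsmall hA.le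
      rwa [inv_mul_cancel₀ hA.ne'] at this
    calc σ ^ (-(e * β / 2)) = 1 * σ ^ (-(e * β / 2)) := (one_mul _).symm
      _ ≤ (c / 2 * σ ^ (-(e * β / 2))) * σ ^ (-(e * β / 2)) :=
          mul_le_mul_of_nonneg_right h1 hA.le
      _ = c * σ ^ (e * -β) / 2 := by rw [hAA]; ring
      _ ≤ ρ₁ tₑ x / 2 := by linarith
      _ ≤ ρ tₑ x := by linarith

/-- **`PolynomialCompression` from the BCG profile fact**: the crux (stmt-AtomisticToContinuum-12587) holds as
soon as the `γ = 5/3` self-similar profile of Buckmaster–Cao-Labora–Gómez-Serrano exists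
(`polynomialCompression_of_typeOne ∘ typeOneIdealImplosion_of_thm11`).
[cite: BuckmasterCaolaboraGomezserrano2025, Thm 1.1] [cite: CaolaboraEtAl2025, Thm 1.2 + Rem 1.4 + Rem 1.5] -/
theorem polynomialCompression_of_thm11 :
    BuckmasterCaolaboraGomezserrano2025_thm11_monatomic →
    Summit.AtomisticToContinuum.HydrodynamicLimit.Theses.ImplosionDichotomy.PolynomialCompression :=
  fun hBCG => polynomialCompression_of_typeOne (typeOneIdealImplosion_of_thm11 hBCG)

/-- **`PolynomialCompression` from the certified left-barrier layer of the BCG shooting window**: the crux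
(stmt-AtomisticToContinuum-12587) holds as soon as the near/far left barriers are certified for every
`r ∈ [r_d, r_u]` (`polynomialCompression_of_typeOne ∘ typeOneIdealImplosion_of_leftHyp`).
[cite: BuckmasterCaolaboraGomezserrano2025, Thm 1.1, Props. 3.1, 3.3, 3.5]
[cite: CaolaboraEtAl2025, Thm 1.2 + Rem 1.4 + Rem 1.5] -/
theorem polynomialCompression_of_leftHyp :
    (∀ r ∈ Icc Shooting.rd Shooting.ru, LeftAsm.LeftHyp r) →
    Summit.AtomisticToContinuum.HydrodynamicLimit.Theses.ImplosionDichotomy.PolynomialCompression :=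
  fun H => polynomialCompression_of_typeOne (typeOneIdealImplosion_of_leftHyp H)

end Summit.AtomisticToContinuum.HydrodynamicLimit.Theorems

end
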